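import Literature.AlgebraicGeometry.Motives.AbelianVarietyIsogenyModelDescent
import Literature.AlgebraicGeometry.ComplexMultiplication.ShimuraIsogenyHolds
import Literature.NumberTheory.ComplexMultiplication.CMDefinedOverQbar
import HarnessLib

/-!
# A complex CM structure `(A, ι)` of type `(K, Φ)` is defined over `ℚ̄` as soon as SOME structure of type `(K, Φ)`
# is (Shimura 1998 §12.4 Prop. 26 via §6.1 Cor. of Thm. 2 and Mumford §7 Thm. 4)

Topic `Literature/NumberTheory/ComplexMultiplication`, namespace `Literature.NumberTheory.ComplexMultiplication`.
THEOREMS ONLY (no definition, no named fact, no instance; net Literature debt 0).  Cell `hodgecm-mathlib`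
(D-0151), row II-2β `shimura1998_prop26_definedOverQbar` (`CMDefinedOverQbar.lean`, B-plan1 p597719), A-p03's
PREP-II2beta-Prop26Qbar: this file COLLAPSES its steps (S5) «compare» and (S6) «the lattice class» — no lattice
bookkeeping is needed:

* `exists_iso_baseChange_of_isCMTypeRealisationOver` — for a realisation `(A, ι, θ)` of `(K; Φ)` over `ℂ` and ANY
  structure `(A₀, ι₀)` of type `(K, Φ)` over an algebraically closed `k ⊆ ℂ` (`IsCMTypeRealisationOver Φ A₀ ι₀`),
  there are `(A₁, ι₁)` over `k` and an `𝓞_K`-equivariant isomorphism `A₁ ⊗_k ℂ ≅ A`: by Shimura §6.1 Cor. of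
  Thm. 2 («any two abelian varieties of the same CM-type are isogenous», tree theorem `Shimura1998_Thm2_Cor_holds`)
  there is an equivariant isogeny `A₀ ⊗ ℂ → A`, and models descend along isogenies
  (`AbelianVariety.exists_iso_baseChange_of_isIsogeny_baseChange`, Mumford §7 Thm. 4);
* `shimura1998_prop26_definedOverQbar_of_forall_exists_isCMTypeRealisationOver` — hence the named fact
  `shimura1998_prop26_definedOverQbar` FOLLOWS from: «for every CM type `(K; Φ)` realised over `ℂ` there is at least
  ONE structure of type `(K, Φ)` over `ℚ̄ = algebraicClosure ℚ ℂ`» (the specialisation steps (S1)–(S4) of the PREP,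
  Shimura's proof p. 109).

## References
* [Shimura1998] G. Shimura, *Abelian Varieties with Complex Multiplication and Modular Functions* (1998), §6.1 Cor. of
  Thm. 2 with Remark (p. 41), §12.4 Prop. 26 (p. 109).
* [MumfordAV1970] D. Mumford, *Abelian Varieties* (1970), §7 Thm. 4 (p. 72).
* [MilneCM2006] J. S. Milne, *Complex Multiplication* (2006), Ch. II Prop. 7.10.
-/

noncomputable section

open CategoryTheory NumberField
open scoped NumberField
open Literature.AlgebraicGeometry.Motives
open Literature.AlgebraicGeometry.HodgeTheory (complexBetti)
open Literature.AlgebraicGeometry.ComplexMultiplication (IsCMTypeRealisation Shimura1998_Thm2_Cor_holds)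

namespace Literature.NumberTheory.ComplexMultiplication

/-- **A complex structure `(A, ι)` of type `(K, Φ)` is defined over any algebraically closed `k ⊆ ℂ` over which
SOME structure of type `(K, Φ)` exists**, equivariantly: from `(A₀, ι₀)` over `k` with `IsCMTypeRealisationOver Φ A₀ ι₀`
one gets `(A₁, ι₁)` over `k` with `A₁ ⊗_k ℂ ≅ A` commuting with the `𝓞_K`-actions (Shimura §6.1 Cor. of Thm. 2:
`A₀ ⊗ ℂ` and `A` are `𝓞_K`-isogenous; Mumford §7 Thm. 4: the target of an isogeny out of `A₀ ⊗ ℂ` is again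
defined over `k`, `AbelianVariety.exists_iso_baseChange_of_isIsogeny_baseChange`). [cite: Shimura1998, §6.1 Cor. of Thm. 2 (p. 41) and §12.4 Prop. 26 (p. 109)]
[cite: MumfordAV1970, §7 Thm. 4 (p. 72)] -/
theorem exists_iso_baseChange_of_isCMTypeRealisationOver {K : Type} [Field K] [NumberField K] [IsCMField K]
    (Φ : CMType K) (A : AbelianVariety ℂ) (ι : 𝓞 K →+* End A)
    (θ : K →+* Module.End ℂ (complexBetti A.X 1)) (hA : IsCMTypeRealisation Φ A ι θ)
    {k : Type} [Field k] [IsAlgClosed k] [CharZero k] [Algebra k ℂ]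
    (A₀ : AbelianVariety k) (ι₀ : 𝓞 K →+* End A₀) (h₀ : IsCMTypeRealisationOver Φ A₀ ι₀) :
    ∃ (A₁ : AbelianVariety k) (ι₁ : 𝓞 K →+* End A₁) (e : A₁.baseChange ℂ ≅ A),
      ∀ a : 𝓞 K, AbelianVariety.Hom.baseChange ℂ (ι₁ a : A₁ ⟶ A₁) ≫ e.hom = e.hom ≫ (ι a : A ⟶ A) := by
  obtain ⟨θ₀, hθ₀⟩ := h₀
  obtain ⟨g, hg, hgι⟩ :=
    Shimura1998_Thm2_Cor_holds K Φ (A₀.baseChange ℂ) ((A₀.endBaseChange ℂ).comp ι₀) θ₀ A ι θ hθ₀ hA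
  exact AbelianVariety.exists_iso_baseChange_of_isIsogeny_baseChange A₀ g hg ι₀ ι fun a => hgι a

/-- **Structures over `k` for isogenous complex varieties**: if `(A₀, ι₀)` over an algebraically closed `k ⊆ ℂ`
and a complex `(A, ι)` admit an `𝓞_K`-equivariant isogeny `A₀ ⊗ ℂ → A`, then `(A, ι) ≅ (A₁ ⊗ ℂ, ι₁ ⊗ ℂ)` for some
`(A₁, ι₁)` over `k` — the CM-free core, restated in the CM binder shape. [cite: MumfordAV1970, §7 Thm. 4 (p. 72)]
[cite: Shimura1998, §12.4 Prop. 26 (p. 109)] -/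
theorem exists_iso_baseChange_of_isIsogeny {K : Type} [Field K] [NumberField K]
    {k : Type} [Field k] [IsAlgClosed k] [CharZero k] [Algebra k ℂ]
    (A₀ : AbelianVariety k) (ι₀ : 𝓞 K →+* End A₀) (A : AbelianVariety ℂ) (ι : 𝓞 K →+* End A)
    (g : A₀.baseChange ℂ ⟶ A) (hg : AbelianVariety.IsIsogeny g)
    (hgι : ∀ a : 𝓞 K, AbelianVariety.Hom.baseChange ℂ (ι₀ a : A₀ ⟶ A₀) ≫ g = g ≫ (ι a : A ⟶ A)) :
    ∃ (A₁ : AbelianVariety k) (ι₁ : 𝓞 K →+* End A₁) (e : A₁.baseChange ℂ ≅ A),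
      ∀ a : 𝓞 K, AbelianVariety.Hom.baseChange ℂ (ι₁ a : A₁ ⟶ A₁) ≫ e.hom = e.hom ≫ (ι a : A ⟶ A) :=
  AbelianVariety.exists_iso_baseChange_of_isIsogeny_baseChange A₀ g hg ι₀ ι hgι

/-- **Reduction of Shimura–Taniyama §12.4 Prop. 26 (`ℚ̄`-form) to the existence of ONE `ℚ̄`-structure per CM type.**
If for every CM type `(K; Φ)` realised by some complex `(A, ι, θ)` there is a structure `(A₀, ι₀)` of type
`(K, Φ)` over `ℚ̄ = algebraicClosure ℚ ℂ`, then EVERY complex structure of type `(K, Φ)` is defined over `ℚ̄`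
(`shimura1998_prop26_definedOverQbar`).  The hypothesis is what the specialisation argument of the printed proof
delivers (p. 109: a generic structure specialises to one over an algebraic extension of `ℚ`).
[cite: Shimura1998, §12.4 Prop. 26 (p. 109)] [cite: MilneCM2006, Ch. II Prop. 7.10] -/
theorem shimura1998_prop26_definedOverQbar_of_forall_exists_isCMTypeRealisationOver
    (h : ∀ (K : Type) [Field K] [NumberField K] [IsCMField K] (Φ : CMType K) (A : AbelianVariety ℂ)
      (ι : 𝓞 K →+* End A) (θ : K →+* Module.End ℂ (complexBetti A.X 1)), IsCMTypeRealisation Φ A ι θ →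
      ∃ (A₀ : AbelianVariety (algebraicClosure ℚ ℂ)) (ι₀ : 𝓞 K →+* End A₀), IsCMTypeRealisationOver Φ A₀ ι₀) :
    shimura1998_prop26_definedOverQbar := by
  intro K _ _ _ Φ A ι θ hA
  obtain ⟨A₀, ι₀, h₀⟩ := h K Φ A ι θ hA
  haveI : IsAlgClosure ℚ (algebraicClosure ℚ ℂ) := algebraicClosure.isAlgClosure ℚ ℂ
  haveI : IsAlgClosed (algebraicClosure ℚ ℂ) := IsAlgClosure.isAlgClosed ℚ
  exact exists_iso_baseChange_of_isCMTypeRealisationOver Φ A ι θ hA A₀ ι₀ h₀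

end Literature.NumberTheory.ComplexMultiplication

end
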